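import Summits.CriticalPhenomena.PercolationContinuityZ3.Theorems.PercNearOneGluingNoHeavyLowerTailSahiMixtureTopSixD

/-!
# The TOP-ROW conjecture (typed) and its proved cases `m ≤ 6`

Support file of the one-cut programme (crux `NoHeavyLowerTail`, stmt-CriticalPhenomena-4575; cell `prim-masterthm`, seat P3, gen 13;
`run/shared/lean/prim/prim-masterthm/prim-masterthm-p3/HIERARCHY.md` §13(e), §21; memo `run/shared/lean/prim/prim-masterthm/FROM-prim-masterthm-p3-g13-TOP-SIX.md`).
CONJECTURE TOP-ROW (this seat; the strong form of gen 6's CONJECTURE P): for every probability weight on a finite type, every `m` and every family of `m` events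
`A_0,…,A_{m−1}`, if the single top row `E_m(1_{A_0},…,1_{A_{m−1}}) ≥ 0` holds then OR-ing an independent coin of bias `h` into ALL members gives a coin
polynomial `h ↦ E_m(μ ⊗ coin(h); 1_{A_0∪H},…,1_{A_{m−1}∪H})` that is Bernstein-positive of degree `m`.
STATUS: proved for `m = 3, 4` (gen 6, `…SahiMixtureTop`), `m = 5` (gen 6, `…TopFive`), `m = 6` (gen 13, `…TopSixA–D`) — collected below as `topRow_three` …
`topRow_six` in the uniform `Fin m`-indexed form of the conjecture; established for `m = 7, 8, 9` by exact integer censuses of the defect pieces (seat scripts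
`code-g13/claimT.c`, `claimT2.c`, kit j134910) but NOT in Lean; OPEN for `m ≥ 10`.  Structural reductions (memo §2, §7): the defect pieces `−T^{(k)}` are manifestly
nonnegative for `k ≥ m/2` at every `m`, and all their negative atom-coefficients sit on monomials containing an atom with at least two failures (the support of
`T^{(1)}`).  An obligation of our theories, never a fact: use as `(h : TopRowConjecture)`.
HONEST FRAMING: nothing here asserts (M⁺-k) or `C_k` for `k ≥ 3`; TOP cells of up-set families under product measures are instances of (M⁺-m). [this work]
-/

noncomputable section

open scoped Classical

namespace Summit.CriticalPhenomena.PercolationContinuityZ3.Theorems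

open Finset Function
open Literature.Combinatorics.Sahi2008
open Literature.Probability.Percolation.DecisionTree (ind)

namespace SahiMixture

/-- **CONJECTURE TOP-ROW** (P3, gens 6/13): the top row alone makes the all-members OR-mixture Bernstein-positive, at every order `m`.
EVIDENCE: theorems for `m ≤ 6` (below), exact censuses for `m ≤ 9` (HIERARCHY §21), exchangeable independent families clean to `m = 20`.  OPEN for `m ≥ 10`.
[status: open] -/
@[conjecture] def TopRowConjecture : Prop :=
  ∀ (α : Type) [Fintype α] (μ : α → ℝ), (∀ a, 0 ≤ μ a) → ∑ a, μ a = 1 →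
    ∀ (m : ℕ) (A : Fin m → Set α), 0 ≤ sahiE μ m (fun j => ind (A j)) →
      BernsteinPos m (fun h => sahiE (coinWeight μ h) m (fun j => ind (orCoin (A j) true)))

section Cases

variable {α : Type*} [Fintype α] {μ : α → ℝ} (hμ : ∀ a, 0 ≤ μ a) (hμ1 : ∑ a, μ a = 1)
include hμ hμ1

/-- TOP-ROW at `m = 3` (gen 6's `bernsteinPos_three_orCoin_top` in `Fin 3`-indexed form). [this work] -/
theorem topRow_three (A : Fin 3 → Set α) (hE : 0 ≤ sahiE μ 3 (fun j => ind (A j))) :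
    BernsteinPos 3 (fun h => sahiE (coinWeight μ h) 3 (fun j => ind (orCoin (A j) true))) := by
  have e1 : (fun j => ind (A j)) = ![ind (A 0), ind (A 1), ind (A 2)] := by
    funext j; fin_cases j <;> rfl
  have e2 : (fun j => ind (orCoin (A j) true)) = ![ind (orCoin (A 0) true), ind (orCoin (A 1) true), ind (orCoin (A 2) true)] := by
    funext j; fin_cases j <;> rfl
  rw [e1] at hE
  simpa only [e2] using bernsteinPos_three_orCoin_top hμ hμ1 (A 0) (A 1) (A 2) hE

/-- TOP-ROW at `m = 4` (gen 6's `bernsteinPos_four_orCoin_top`). [this work] -/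
theorem topRow_four (A : Fin 4 → Set α) (hE : 0 ≤ sahiE μ 4 (fun j => ind (A j))) :
    BernsteinPos 4 (fun h => sahiE (coinWeight μ h) 4 (fun j => ind (orCoin (A j) true))) := by
  have e1 : (fun j => ind (A j)) = ![ind (A 0), ind (A 1), ind (A 2), ind (A 3)] := by
    funext j; fin_cases j <;> rfl
  have e2 : (fun j => ind (orCoin (A j) true))
      = ![ind (orCoin (A 0) true), ind (orCoin (A 1) true), ind (orCoin (A 2) true), ind (orCoin (A 3) true)] := by
    funext j; fin_cases j <;> rfl
  rw [e1] at hE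
  simpa only [e2] using bernsteinPos_four_orCoin_top hμ hμ1 (A 0) (A 1) (A 2) (A 3) hE

/-- TOP-ROW at `m = 5` (gen 6's `bernsteinPos_five_orCoin_top`). [this work] -/
theorem topRow_five (A : Fin 5 → Set α) (hE : 0 ≤ sahiE μ 5 (fun j => ind (A j))) :
    BernsteinPos 5 (fun h => sahiE (coinWeight μ h) 5 (fun j => ind (orCoin (A j) true))) := by
  have e1 : (fun j => ind (A j)) = ![ind (A 0), ind (A 1), ind (A 2), ind (A 3), ind (A 4)] := by
    funext j; fin_cases j <;> rfl
  have e2 : (fun j => ind (orCoin (A j) true))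
      = ![ind (orCoin (A 0) true), ind (orCoin (A 1) true), ind (orCoin (A 2) true), ind (orCoin (A 3) true), ind (orCoin (A 4) true)] := by
    funext j; fin_cases j <;> rfl
  rw [e1] at hE
  simpa only [e2] using bernsteinPos_five_orCoin_top hμ hμ1 (A 0) (A 1) (A 2) (A 3) (A 4) hE

/-- TOP-ROW at `m = 6` (this gen's `bernsteinPos_six_orCoin_top`). [this work] -/
theorem topRow_six (A : Fin 6 → Set α) (hE : 0 ≤ sahiE μ 6 (fun j => ind (A j))) :
    BernsteinPos 6 (fun h => sahiE (coinWeight μ h) 6 (fun j => ind (orCoin (A j) true))) :=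
  bernsteinPos_six_orCoin_top hμ hμ1 A hE

end Cases

/-- **TOP-ROW holds at every order `3 ≤ m ≤ 6`** (uniform statement). [this work] -/
theorem topRowConjecture_of_le_six {α : Type} [Fintype α] (μ : α → ℝ) (hμ : ∀ a, 0 ≤ μ a) (hμ1 : ∑ a, μ a = 1)
    {m : ℕ} (h3 : 3 ≤ m) (h6 : m ≤ 6) (A : Fin m → Set α) (hE : 0 ≤ sahiE μ m (fun j => ind (A j))) :
    BernsteinPos m (fun h => sahiE (coinWeight μ h) m (fun j => ind (orCoin (A j) true))) := by
  interval_cases m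
  · exact topRow_three hμ hμ1 A hE
  · exact topRow_four hμ hμ1 A hE
  · exact topRow_five hμ hμ1 A hE
  · exact topRow_six hμ hμ1 A hE

end SahiMixture

end Summit.CriticalPhenomena.PercolationContinuityZ3.Theorems

end
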